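import Mathlib
import HarnessLib

/-!
# The Brégman–Minc inequality in set form

For a finite set `X` of permutations of a finite type `α` write `r_i = #{σ i : σ ∈ X}` for the size
of the `i`-th *row support* of `X`.  Then (`log_card_le_sum_log_factorial_div`,
`card_le_prod_factorial_rpow`)

  `log #X ≤ ∑_i log (r_i !) / r_i`  (`X ≠ ∅`),  equivalently  `#X ≤ ∏_i (r_i !)^(1/r_i)`.

This is Brégman's theorem [Bregman1973, Thm 1] (Minc's conjecture [Minc1963])
`per A ≤ ∏_i (r_i !)^(1/r_i)` for the `0/1` matrix `A` recording the row supports of `X`, combined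
with `#X ≤ per A`.  We prove the set form directly by Schrijver's argument [Schrijver1978]: strong
induction on `X`; for every non-constant row `i` the log-sum inequality gives
`P log P ≤ P log r_i + ∑_{σ ∈ X} log P_{i,σ i}` (`P = #X`, `P_{ik} = #{τ ∈ X : τ i = k}`,
`sum_mul_log_sum_le`, `card_mul_log_card_le_sum_log_fiber`); the induction hypothesis bounds
`log P_{i,σ i}` through the row supports of the minor `{τ ∈ X : τ i = σ i}`
(`log_card_filter_le_of_ih`); Schrijver's count `#{i : σ i ∈ supp_j} = r_j`
(`sum_bregman_minor_terms`) and the monotonicity of `r ↦ log (r !) / r` close the induction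
(`log_card_le_of_bregman_step`, pure bookkeeping).  No permanents or matrices are introduced.

References: L. M. Brégman, Some properties of nonnegative matrices and their permanents, *Soviet
Math. Dokl.* 14 (1973) 945–949 [Bregman1973]; A. Schrijver, A short proof of Minc's conjecture,
*J. Combin. Theory Ser. A* 25 (1978) 80–83 [Schrijver1978]; H. Minc, Upper bounds for permanents of
(0,1)-matrices, *Bull. Amer. Math. Soc.* 69 (1963) 789–791 [Minc1963].
-/

namespace Literature.Combinatorics.Enumerative

open Finset

/-! ### The Brégman exponent `g r = log (r !) / r` -/

/-- `log (m !) / m ≥ 0`. [folklore] -/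
theorem log_factorial_div_nonneg (m : ℕ) : 0 ≤ Real.log (m.factorial : ℝ) / (m : ℝ) :=
  div_nonneg (Real.log_nonneg (by exact_mod_cast m.factorial_pos)) (Nat.cast_nonneg m)

/-- `log (m !) / m = 0` for `m ≤ 1`. [folklore] -/
theorem log_factorial_div_eq_zero_of_le_one {m : ℕ} (hm : m ≤ 1) :
    Real.log (m.factorial : ℝ) / (m : ℝ) = 0 := by
  interval_cases m <;> simp

/-- `log ((m+1) !) = log (m+1) + log (m !)`. [folklore] -/
theorem log_factorial_succ (m : ℕ) :
    Real.log ((m + 1).factorial : ℝ) = Real.log ((m + 1 : ℕ) : ℝ) + Real.log (m.factorial : ℝ) := by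
  rw [Nat.factorial_succ, Nat.cast_mul, Real.log_mul]
  · exact_mod_cast (Nat.succ_ne_zero m)
  · exact_mod_cast (Nat.factorial_ne_zero m)

/-- `r ↦ log (r !) / r` is monotone on `ℕ` (one step: `m ! ≤ (m+1)^m`). [folklore] -/
theorem log_factorial_div_mono :
    Monotone (fun m : ℕ => Real.log (m.factorial : ℝ) / (m : ℝ)) := by
  refine monotone_nat_of_le_succ fun m => ?_
  rcases Nat.eq_zero_or_pos m with rfl | hm
  · simp
  have hm' : (0 : ℝ) < m := by exact_mod_cast hm
  have hpow : (m.factorial : ℝ) ≤ ((m : ℝ) + 1) ^ m := by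
    exact_mod_cast (Nat.factorial_le_pow m).trans (Nat.pow_le_pow_left (Nat.le_succ m) m)
  have hlog : Real.log (m.factorial : ℝ) ≤ m * Real.log ((m : ℝ) + 1) := by
    rw [← Real.log_pow]
    exact Real.log_le_log (by exact_mod_cast m.factorial_pos) hpow
  rw [log_factorial_succ, Nat.cast_succ, div_le_div_iff₀ hm' (by linarith)]
  nlinarith [hlog, hm']

/-- The bookkeeping identity behind Schrijver's induction step, for one column with row support
size `r ≥ 1`: `log r + (r-1)·g(r-1) + (m - (r-1))·g(r) = c·g(r)` where `g r = log (r !) / r`,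
`c` is the number of non-constant rows and `m` the number of non-constant rows other than the
column's own row (`m = c - 1` if `r ≥ 2`, `m = c` if `r = 1`). [folklore] -/
theorem log_add_bregman_terms (r : ℕ) (hr : 1 ≤ r) (c m : ℝ)
    (hm : m = if 2 ≤ r then c - 1 else c) :
    Real.log (r : ℝ) +
        (((r - 1 : ℕ) : ℝ) * (Real.log ((r - 1).factorial : ℝ) / ((r - 1 : ℕ) : ℝ)) +
          (m - ((r - 1 : ℕ) : ℝ)) * (Real.log (r.factorial : ℝ) / (r : ℝ))) =
      c * (Real.log (r.factorial : ℝ) / (r : ℝ)) := by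
  obtain ⟨q, rfl⟩ : ∃ q, r = q + 1 := ⟨r - 1, by omega⟩
  simp only [Nat.add_sub_cancel] at hm ⊢
  rcases Nat.eq_zero_or_pos q with rfl | hq
  · simp
  rw [if_pos (by omega)] at hm
  subst hm
  have hq0 : (q : ℝ) ≠ 0 := by exact_mod_cast hq.ne'
  have hq1 : ((q + 1 : ℕ) : ℝ) ≠ 0 := by exact_mod_cast Nat.succ_ne_zero q
  rw [mul_div_assoc', mul_div_cancel_left₀ _ hq0, log_factorial_succ]
  field_simp
  push_cast
  ring

/-! ### The log-sum inequality -/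

/-- Log-sum inequality (Jensen for `x log x` with uniform weights, via `log x ≤ x - 1`): for
positive reals `p k`, `k ∈ t`, with sum `P`, `P log P ≤ P log #t + ∑_k p_k log p_k`. [folklore] -/
theorem sum_mul_log_sum_le {κ : Type*} (t : Finset κ) (p : κ → ℝ) (hp : ∀ k ∈ t, 0 < p k) :
    (∑ k ∈ t, p k) * Real.log (∑ k ∈ t, p k) ≤
      (∑ k ∈ t, p k) * Real.log (t.card : ℝ) + ∑ k ∈ t, p k * Real.log (p k) := by
  rcases t.eq_empty_or_nonempty with rfl | ht
  · simp
  set P := ∑ k ∈ t, p k with hP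
  have hPpos : 0 < P := Finset.sum_pos hp ht
  have htpos : (0 : ℝ) < t.card := by exact_mod_cast ht.card_pos
  have key : ∀ k ∈ t,
      p k * (Real.log P - Real.log (t.card : ℝ) - Real.log (p k)) ≤ P / t.card - p k := by
    intro k hk
    have hpk := hp k hk
    have h1 : Real.log (P / (t.card * p k)) ≤ P / (t.card * p k) - 1 :=
      Real.log_le_sub_one_of_pos (by positivity)
    rw [Real.log_div hPpos.ne' (by positivity), Real.log_mul htpos.ne' hpk.ne'] at h1
    have h3 : p k * (P / (t.card * p k) - 1) = P / t.card - p k := by field_simp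
    rw [← sub_sub] at h1
    rw [← h3]
    exact mul_le_mul_of_nonneg_left h1 hpk.le
  have hsum := Finset.sum_le_sum key
  have lhs : ∑ k ∈ t, p k * (Real.log P - Real.log (t.card : ℝ) - Real.log (p k)) =
      P * Real.log P - P * Real.log (t.card : ℝ) - ∑ k ∈ t, p k * Real.log (p k) := by
    simp only [mul_sub, Finset.sum_sub_distrib, ← Finset.sum_mul, ← hP]
  have rhs : ∑ k ∈ t, (P / t.card - p k) = 0 := by
    rw [Finset.sum_sub_distrib, Finset.sum_const, nsmul_eq_mul, ← hP]
    field_simp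
    ring
  rw [lhs, rhs] at hsum
  linarith

/-- Fibre form of the log-sum inequality: for a finite set `s` and a map `f`,
`#s · log #s ≤ #s · log #(f '' s) + ∑_{a ∈ s} log #{b ∈ s | f b = f a}`. [folklore] -/
theorem card_mul_log_card_le_sum_log_fiber {β γ : Type*} [DecidableEq γ] (s : Finset β)
    (f : β → γ) :
    (s.card : ℝ) * Real.log (s.card : ℝ) ≤
      (s.card : ℝ) * Real.log ((s.image f).card : ℝ) +
        ∑ a ∈ s, Real.log ((s.filter (fun b => f b = f a)).card : ℝ) := by
  have hfib : ∑ a ∈ s, Real.log ((s.filter (fun b => f b = f a)).card : ℝ) =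
      ∑ k ∈ s.image f, ((s.filter (fun b => f b = k)).card : ℝ) *
        Real.log ((s.filter (fun b => f b = k)).card : ℝ) := by
    rw [Finset.sum_comp (fun k => Real.log ((s.filter (fun b => f b = k)).card : ℝ)) f]
    simp only [nsmul_eq_mul]
  have hcard : (s.card : ℝ) = ∑ k ∈ s.image f, ((s.filter (fun b => f b = k)).card : ℝ) := by
    rw [Finset.card_eq_sum_card_image f s]
    push_cast
    rfl
  rw [hfib, hcard]
  refine sum_mul_log_sum_le _ _ fun k hk => ?_
  obtain ⟨b, hb, rfl⟩ := Finset.mem_image.mp hk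
  have hpos : 0 < (s.filter (fun b' => f b' = f b)).card :=
    Finset.card_pos.mpr ⟨b, Finset.mem_filter.mpr ⟨hb, rfl⟩⟩
  exact_mod_cast hpos

/-! ### Row supports of sets of permutations -/

section Permutations

variable {α : Type*} [DecidableEq α]

/-- Fixing the value `σ i` in row `i` removes that value from every other row support: for `j ≠ i`,
`{τ j : τ ∈ X, τ i = σ i} ⊆ {τ j : τ ∈ X} \ {σ i}`. [folklore] -/
theorem image_filter_apply_subset_erase (X : Finset (Equiv.Perm α)) (σ : Equiv.Perm α) {i j : α}
    (hij : j ≠ i) :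
    (X.filter (fun τ => τ i = σ i)).image (fun τ => τ j) ⊆ (X.image (fun τ => τ j)).erase (σ i) := by
  intro k hk
  simp only [Finset.mem_image, Finset.mem_filter] at hk
  obtain ⟨τ, ⟨hτX, hτi⟩, rfl⟩ := hk
  refine Finset.mem_erase.mpr ⟨?_, Finset.mem_image_of_mem _ hτX⟩
  rw [← hτi]
  exact fun h => hij (τ.injective h)

/-- A row with at least two values contains, for every `σ`, some `τ ∈ X` with `τ i ≠ σ i`.
[folklore] -/
theorem exists_mem_apply_ne (X : Finset (Equiv.Perm α)) (σ : Equiv.Perm α) (i : α)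
    (h : 2 ≤ (X.image (fun τ => τ i)).card) : ∃ τ ∈ X, τ i ≠ σ i := by
  obtain ⟨a, ha, b, hb, hab⟩ := Finset.one_lt_card.mp h
  obtain ⟨τa, hτa, rfl⟩ := Finset.mem_image.mp ha
  obtain ⟨τb, hτb, rfl⟩ := Finset.mem_image.mp hb
  by_cases h' : τa i = σ i
  · exact ⟨τb, hτb, fun h'' => hab (h'.trans h''.symm)⟩
  · exact ⟨τa, hτa, h'⟩

/-- The value of a constant row appears in no other row support: if row `i` of `X` takes at most one
value, `σ ∈ X` and `i ≠ j`, then `σ i ∉ {τ j : τ ∈ X}`. [folklore] -/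
theorem apply_not_mem_image_of_card_le_one (X : Finset (Equiv.Perm α)) {σ : Equiv.Perm α}
    (hσ : σ ∈ X) {i j : α} (hij : i ≠ j) (hi : (X.image (fun τ => τ i)).card ≤ 1) :
    σ i ∉ X.image (fun τ => τ j) := by
  intro h
  obtain ⟨τ, hτ, hτj⟩ := Finset.mem_image.mp h
  have hτi : τ i = σ i :=
    Finset.card_le_one.mp hi _ (Finset.mem_image_of_mem _ hτ) _ (Finset.mem_image_of_mem _ hσ)
  exact hij (τ.injective (hτi.trans hτj.symm))

variable [Fintype α]

/-- For a permutation `σ` and a set of values `S`, exactly `#S` rows `i` have `σ i ∈ S`. [folklore] -/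
theorem card_filter_apply_mem (σ : Equiv.Perm α) (S : Finset α) :
    (Finset.univ.filter (fun i => σ i ∈ S)).card = S.card := by
  have : Finset.univ.filter (fun i => σ i ∈ S) = S.image σ.symm := by
    ext i
    simp only [Finset.mem_filter, Finset.mem_univ, true_and, Finset.mem_image]
    exact ⟨fun h => ⟨σ i, h, σ.symm_apply_apply i⟩, fun ⟨k, hk, hki⟩ => by subst hki; simpa using hk⟩
  rw [this, Finset.card_image_of_injective _ σ.symm.injective]

/-- Transfer of the induction hypothesis to the minor `X' = {τ ∈ X : τ i = σ i}`: its Brégman sum is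
at most `∑_{j ≠ i} g #({τ j : τ ∈ X} \ {σ i})` (`g r = log (r !) / r`), because row `i` of `X'` is
constant (`g 0 = g 1 = 0`) and its other row supports avoid `σ i` (`g` is monotone). [folklore] -/
theorem log_card_filter_le_of_ih (X : Finset (Equiv.Perm α)) (σ : Equiv.Perm α) (i : α)
    (h : Real.log ((X.filter (fun τ => τ i = σ i)).card : ℝ) ≤
      ∑ j, Real.log ((((X.filter (fun τ => τ i = σ i)).image (fun τ => τ j)).card.factorial : ℕ) : ℝ) /
        (((X.filter (fun τ => τ i = σ i)).image (fun τ => τ j)).card : ℝ)) :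
    Real.log ((X.filter (fun τ => τ i = σ i)).card : ℝ) ≤
      ∑ j ∈ Finset.univ.erase i,
        Real.log ((((X.image (fun τ => τ j)).erase (σ i)).card.factorial : ℕ) : ℝ) /
          (((X.image (fun τ => τ j)).erase (σ i)).card : ℝ) := by
  have hi : ((X.filter (fun τ => τ i = σ i)).image (fun τ => τ i)).card ≤ 1 := by
    refine (Finset.card_le_card fun k hk => ?_).trans (Finset.card_singleton (σ i)).le
    simp only [Finset.mem_image, Finset.mem_filter] at hk
    obtain ⟨τ, ⟨-, hτi⟩, rfl⟩ := hk
    simpa using hτi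
  refine h.trans ?_
  rw [← Finset.add_sum_erase _ _ (Finset.mem_univ i), log_factorial_div_eq_zero_of_le_one hi,
    zero_add]
  exact Finset.sum_le_sum fun j hj => log_factorial_div_mono (Finset.card_le_card
    (image_filter_apply_subset_erase X σ (Finset.ne_of_mem_erase hj)))

/-- Schrijver's count, for `σ ∈ X`, a column `j` with row support `S = {τ j : τ ∈ X}` of size `r`
and any `g`: among the non-constant rows `i ≠ j`, exactly `r - 1` have `σ i ∈ S`
(there `#(S \ {σ i}) = r - 1`), and the remaining ones have `#(S \ {σ i}) = r`. [folklore] -/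
theorem sum_bregman_minor_terms (g : ℕ → ℝ) (X : Finset (Equiv.Perm α)) {σ : Equiv.Perm α}
    (hσ : σ ∈ X) (j : α) :
    ∑ i ∈ (Finset.univ.filter (fun i => 2 ≤ (X.image (fun τ => τ i)).card)).erase j,
        g ((X.image (fun τ => τ j)).erase (σ i)).card =
      (((X.image (fun τ => τ j)).card - 1 : ℕ) : ℝ) * g ((X.image (fun τ => τ j)).card - 1) +
        ((((Finset.univ.filter (fun i => 2 ≤ (X.image (fun τ => τ i)).card)).erase j).card : ℝ) -
            (((X.image (fun τ => τ j)).card - 1 : ℕ) : ℝ)) * g (X.image (fun τ => τ j)).card := by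
  set S := X.image (fun τ => τ j) with hS
  set R := Finset.univ.filter (fun i => 2 ≤ (X.image (fun τ => τ i)).card) with hR
  have hA : (R.erase j).filter (fun i => σ i ∈ S) =
      (Finset.univ.filter (fun i => σ i ∈ S)).erase j := by
    ext i
    simp only [Finset.mem_filter, Finset.mem_erase, Finset.mem_univ, true_and, hR]
    refine ⟨fun ⟨⟨hij, _⟩, hi⟩ => ⟨hij, hi⟩, fun ⟨hij, hi⟩ => ⟨⟨hij, ?_⟩, hi⟩⟩
    by_contra hlt
    exact apply_not_mem_image_of_card_le_one X hσ hij (by omega) hi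
  have hjmem : j ∈ Finset.univ.filter (fun i => σ i ∈ S) :=
    Finset.mem_filter.mpr ⟨Finset.mem_univ _, Finset.mem_image_of_mem (fun τ => τ j) hσ⟩
  have hAcard : ((R.erase j).filter (fun i => σ i ∈ S)).card = S.card - 1 := by
    rw [hA, Finset.card_erase_of_mem hjmem, card_filter_apply_mem]
  have hsplit := Finset.card_filter_add_card_filter_not (s := R.erase j) (fun i => σ i ∈ S)
  rw [← Finset.sum_filter_add_sum_filter_not (R.erase j) (fun i => σ i ∈ S),
    Finset.sum_eq_card_nsmul (b := g (S.card - 1))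
      (fun i hi => by rw [Finset.card_erase_of_mem (Finset.mem_filter.mp hi).2]),
    Finset.sum_eq_card_nsmul (b := g S.card)
      (fun i hi => by rw [Finset.erase_eq_of_notMem (Finset.mem_filter.mp hi).2]),
    nsmul_eq_mul, nsmul_eq_mul, hAcard, ← hsplit, hAcard]
  push_cast
  ring

end Permutations

/-! ### Schrijver's induction -/

/-- Schrijver's induction step as pure bookkeeping.  Data: a nonempty finite set `X` (`P = #X`), row
support sizes `r j ≥ 1` with non-constant rows `R = {i | 2 ≤ r i} ≠ ∅`, an exponent function `g`
with the column identity of `log_add_bregman_terms`, reals `L i σ` (think `log #{τ ∈ X : τ i = σ i}`)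
and `E σ i j` (think `g #({τ j : τ ∈ X} \ {σ i})`).  If every non-constant row satisfies
`P log P ≤ P log r_i + ∑_σ L i σ`, every minor `L i σ ≤ ∑_{j ≠ i} E σ i j`, and the column count
`∑_{i ∈ R \ {j}} E σ i j = (r_j - 1) g(r_j - 1) + (#(R \ {j}) - (r_j - 1)) g(r_j)` holds, then
`log P ≤ ∑_j g(r_j)`. [folklore] -/
theorem log_card_le_of_bregman_step {α β : Type*} [Fintype α] [DecidableEq α] (X : Finset β)
    (hX : X.Nonempty) (g : ℕ → ℝ) (r : α → ℕ) (hr : ∀ j, 1 ≤ r j) (L : α → β → ℝ)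
    (E : β → α → α → ℝ)
    (hg : ∀ q : ℕ, 1 ≤ q → ∀ c m : ℝ, (m = if 2 ≤ q then c - 1 else c) →
      Real.log (q : ℝ) + (((q - 1 : ℕ) : ℝ) * g (q - 1) + (m - ((q - 1 : ℕ) : ℝ)) * g q) = c * g q)
    (hR : (Finset.univ.filter (fun i => 2 ≤ r i)).Nonempty)
    (hrow : ∀ i ∈ Finset.univ.filter (fun i => 2 ≤ r i),
      (X.card : ℝ) * Real.log (X.card : ℝ) ≤ (X.card : ℝ) * Real.log (r i : ℝ) + ∑ σ ∈ X, L i σ)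
    (hminor : ∀ i ∈ Finset.univ.filter (fun i => 2 ≤ r i), ∀ σ ∈ X,
      L i σ ≤ ∑ j ∈ Finset.univ.erase i, E σ i j)
    (hcount : ∀ σ ∈ X, ∀ j, ∑ i ∈ (Finset.univ.filter (fun i => 2 ≤ r i)).erase j, E σ i j =
      ((r j - 1 : ℕ) : ℝ) * g (r j - 1) +
        ((((Finset.univ.filter (fun i => 2 ≤ r i)).erase j).card : ℝ) - ((r j - 1 : ℕ) : ℝ)) *
          g (r j)) :
    Real.log (X.card : ℝ) ≤ ∑ j, g (r j) := by
  set R := Finset.univ.filter (fun i => 2 ≤ r i) with hRdef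
  set P : ℝ := (X.card : ℝ) with hPdef
  have hP : 0 < P := by
    rw [hPdef]
    exact_mod_cast hX.card_pos
  -- (1) sum the row inequalities over the non-constant rows
  have h1 : (R.card : ℝ) * (P * Real.log P) ≤
      P * ∑ i ∈ R, Real.log (r i : ℝ) + ∑ σ ∈ X, ∑ i ∈ R, L i σ := by
    have := Finset.sum_le_sum hrow
    rwa [Finset.sum_const, nsmul_eq_mul, Finset.sum_add_distrib, ← Finset.mul_sum,
      Finset.sum_comm] at this
  -- (2) bound every minor
  have h2 : ∑ σ ∈ X, ∑ i ∈ R, L i σ ≤ ∑ σ ∈ X, ∑ i ∈ R, ∑ j ∈ Finset.univ.erase i, E σ i j :=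
    Finset.sum_le_sum fun σ hσ => Finset.sum_le_sum fun i hi => hminor i hi σ hσ
  -- (3) exchange the two inner sums and count column by column
  have h3 : ∑ σ ∈ X, ∑ i ∈ R, ∑ j ∈ Finset.univ.erase i, E σ i j =
      P * ∑ j, (((r j - 1 : ℕ) : ℝ) * g (r j - 1) +
        (((R.erase j).card : ℝ) - ((r j - 1 : ℕ) : ℝ)) * g (r j)) := by
    rw [hPdef, ← nsmul_eq_mul, ← Finset.sum_const]
    refine Finset.sum_congr rfl fun σ hσ => ?_
    rw [Finset.sum_comm' (t' := Finset.univ) (s' := fun j => R.erase j)]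
    · exact Finset.sum_congr rfl fun j _ => hcount σ hσ j
    · intro i j
      simp only [Finset.mem_erase, Finset.mem_univ, and_true]
      tauto
  -- (4) constant rows contribute `log 1 = 0` to the row-log sum
  have h4 : ∑ i ∈ R, Real.log (r i : ℝ) = ∑ j, Real.log (r j : ℝ) := by
    refine Finset.sum_subset (Finset.subset_univ R) fun j _ hj => ?_
    have hj1 : r j = 1 := by
      have := hr j
      simp only [hRdef, Finset.mem_filter, Finset.mem_univ, true_and, not_le] at hj
      omega
    simp [hj1]
  -- (5) the per-column identity
  have h5 : ∀ j, Real.log (r j : ℝ) + (((r j - 1 : ℕ) : ℝ) * g (r j - 1) +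
      (((R.erase j).card : ℝ) - ((r j - 1 : ℕ) : ℝ)) * g (r j)) = R.card * g (r j) := by
    intro j
    apply hg (r j) (hr j)
    rw [Finset.card_erase_eq_ite]
    by_cases hj : 2 ≤ r j
    · have hjR : j ∈ R := by simp [hRdef, hj]
      rw [if_pos hjR, if_pos hj, Nat.cast_sub (Finset.card_pos.mpr ⟨j, hjR⟩), Nat.cast_one]
    · have hjR : j ∉ R := by simp [hRdef, hj]
      rw [if_neg hjR, if_neg hj]
  -- (6) combine and divide by `#R · P > 0`
  have h6 : (R.card : ℝ) * P * Real.log P ≤ (R.card : ℝ) * P * ∑ j, g (r j) := by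
    calc (R.card : ℝ) * P * Real.log P
        ≤ P * ∑ j, Real.log (r j : ℝ) + P * ∑ j, (((r j - 1 : ℕ) : ℝ) * g (r j - 1) +
            (((R.erase j).card : ℝ) - ((r j - 1 : ℕ) : ℝ)) * g (r j)) := by
          rw [← h4, ← h3, mul_assoc]
          exact h1.trans (by linarith [h2])
      _ = P * ∑ j, (R.card : ℝ) * g (r j) := by
          rw [← mul_add, ← Finset.sum_add_distrib]
          exact congrArg _ (Finset.sum_congr rfl fun j _ => h5 j)
      _ = (R.card : ℝ) * P * ∑ j, g (r j) := by
          rw [← Finset.mul_sum]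
          ring
  have hRpos : (0 : ℝ) < R.card := by exact_mod_cast hR.card_pos
  exact le_of_mul_le_mul_left h6 (by positivity)

/-- **The Brégman–Minc inequality in set form (logarithmic).**  For a nonempty finite set `X` of
permutations of a finite type `α` with row supports `r_i = #{σ i : σ ∈ X}`,
`log #X ≤ ∑_i log (r_i !) / r_i`: Brégman's theorem `per A ≤ ∏_i (r_i !)^(1/r_i)` (Minc's
conjecture) for the `0/1` support pattern `A` of `X`, via `#X ≤ per A`; Schrijver's proof, run
directly on sets of permutations by strong induction on `X`. [cite: Bregman1973, Thm 1] -/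
theorem log_card_le_sum_log_factorial_div {α : Type*} [Fintype α] [DecidableEq α]
    (X : Finset (Equiv.Perm α)) (hX : X.Nonempty) :
    Real.log (X.card : ℝ) ≤
      ∑ i, Real.log (((X.image (fun σ => σ i)).card.factorial : ℕ) : ℝ) /
        ((X.image (fun σ => σ i)).card : ℝ) := by
  induction X using Finset.strongInduction with
  | H X ih =>
    by_cases hR : (Finset.univ.filter (fun i => 2 ≤ (X.image (fun σ => σ i)).card)).Nonempty
    · obtain ⟨σ₀, hσ₀⟩ := hX
      refine (log_card_le_of_bregman_step X ⟨σ₀, hσ₀⟩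
        (fun m => Real.log (m.factorial : ℝ) / (m : ℝ))
        (fun j => (X.image (fun σ => σ j)).card)
        (fun j => Finset.card_pos.mpr ⟨σ₀ j, Finset.mem_image_of_mem (fun σ => σ j) hσ₀⟩)
        (fun i σ => Real.log ((X.filter (fun τ => τ i = σ i)).card : ℝ))
        (fun σ i j => Real.log ((((X.image (fun τ => τ j)).erase (σ i)).card.factorial : ℕ) : ℝ) /
          (((X.image (fun τ => τ j)).erase (σ i)).card : ℝ))
        log_add_bregman_terms hR
        (fun i _ => card_mul_log_card_le_sum_log_fiber X (fun σ => σ i))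
        (fun i hi σ hσ => log_card_filter_le_of_ih X σ i (ih _ ?_ ?_))
        (fun σ hσ j => sum_bregman_minor_terms (fun m => Real.log (m.factorial : ℝ) / (m : ℝ))
          X hσ j) :)
      · exact Finset.filter_ssubset.mpr (exists_mem_apply_ne X σ i (Finset.mem_filter.mp hi).2)
      · exact ⟨σ, Finset.mem_filter.mpr ⟨hσ, rfl⟩⟩
    · have hle : ∀ i, (X.image (fun σ => σ i)).card ≤ 1 := fun i => by
        by_contra h
        exact hR ⟨i, Finset.mem_filter.mpr ⟨Finset.mem_univ i, by omega⟩⟩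
      have h1 : X.card = 1 := le_antisymm (Finset.card_le_one.mpr fun _ hσ _ hτ => Equiv.ext fun i =>
        Finset.card_le_one.mp (hle i) _ (Finset.mem_image_of_mem _ hσ) _
          (Finset.mem_image_of_mem _ hτ)) hX.card_pos
      rw [h1, Nat.cast_one, Real.log_one]
      exact Finset.sum_nonneg fun i _ => log_factorial_div_nonneg _

/-- **The Brégman–Minc inequality in set form (product form).**  For a finite set `X` of
permutations of a finite type `α` with row supports `r_i = #{σ i : σ ∈ X}`,
`#X ≤ ∏_i (r_i !)^(1/r_i)` (Brégman 1973 = Minc's conjecture 1963; for `X = ∅` the factors read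
`0 ! ^ (1/0) = 1`). [cite: Bregman1973, Thm 1] -/
theorem card_le_prod_factorial_rpow {α : Type*} [Fintype α] [DecidableEq α]
    (X : Finset (Equiv.Perm α)) :
    (X.card : ℝ) ≤ ∏ i, (((X.image (fun σ => σ i)).card.factorial : ℕ) : ℝ) ^
        ((1 : ℝ) / ((X.image (fun σ => σ i)).card : ℝ)) := by
  have hfpos : ∀ i, (0 : ℝ) < (((X.image (fun σ => σ i)).card.factorial : ℕ) : ℝ) := fun i => by
    exact_mod_cast Nat.factorial_pos _
  have hprod : (0 : ℝ) < ∏ i, (((X.image (fun σ => σ i)).card.factorial : ℕ) : ℝ) ^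
      ((1 : ℝ) / ((X.image (fun σ => σ i)).card : ℝ)) :=
    Finset.prod_pos fun i _ => Real.rpow_pos_of_pos (hfpos i) _
  rcases X.eq_empty_or_nonempty with rfl | hX
  · rw [Finset.card_empty, Nat.cast_zero]
    exact hprod.le
  rw [← Real.log_le_log_iff (by exact_mod_cast hX.card_pos) hprod,
    Real.log_prod (fun i _ => (Real.rpow_pos_of_pos (hfpos i) _).ne')]
  refine (log_card_le_sum_log_factorial_div X hX).trans (le_of_eq (Finset.sum_congr rfl fun i _ => ?_))
  rw [Real.log_rpow (hfpos i)]
  ring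

end Literature.Combinatorics.Enumerative
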